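import Summits.QuantumFields.BalabanUV.T4Continuum.Support.NE7ClassFluxGradBound
import Summits.QuantumFields.BalabanUV.T4Continuum.Support.NE7ClassCurrentBoundGeneric
import HarnessLib

/-!
# NE7ClassFluxGradBoundGeneric — PORT MAP P3.7 (part 1∕2): gen 108's (c6) `NE7ClassFluxGradBound.exists_classFluxGradConst` AT `d = 4`, ANY BLOCK SIZE `L ≥ 2`, ANY `U(n)` —
# (10) TYPE UP TO A LOGARITHM for our tangent-critical configurations of the class, read as ONE k-free constant: `‖∇_U F(x; j, π)‖ ≤ C(L, card n)·ε·(1 + (k+1))∕M³`,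
# `M = L^{k+1}`, for every tangent-critical `U ∈ admissible (sfClass 4 L N ε) L (k+1) D`, under the displayed ε-lines `ε ≤ 1∕50`, `2·thetaLoc 4 L·ε ≤ 1` and the level family
# `∀ k, LevelSmall 4 L k (ε∕(L^{k+1})²)` (the record's `L = 2` numerics `ε ≤ 10⁻⁵³`, `thetaLoc 4 2 < 10¹⁹`, `levelSmall_all_d4_L2` are exactly these)

Cell `pub-balaban`, rung (B)+1 sub-cell t4, lineage `b2b-balaban-t4-ne7b-p1` (row NE7b OWNER + CRUX PROVER), generation 156 — PORT MAP item P3.7 of the road t4-ne7-p1 g109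
([NE7P1-G109-INBOX-3]; memo `t4/b2b-balaban-t4-ne7-p1-g109/ROAD-G109.md` §3, recipe `2 ↦ L`), claimed [NE7bP1-G156-INBOX-6].  Inputs: gen 108's (c5)
`NE7FluxGradOfTanCritical.fluxGrad_le_of_tanCritical` (stated at every block size, scale `m`; here `m = M = L^{k+1}`, `a = x = ε∕M²`), the road's ✓ p808009
`NE7ClassCurrentBoundGeneric.geom_identity` (`M⁴∕M²·(L∕L⁴)^{k+1} = M⁻¹`).  THE BLOCK-SIZE LOGARITHM: `1 + log M = 1 + (k+1)·log L ≤ (1 + log L)·(1 + (k+1))`, so the constant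
carries the factor `Λ = 1 + log L` (as in the road's ✓ p810907 `covGrad_rate_le_generic`: `K_G := K_G⁰(1 + log L)`).
ARITHMETIC (`M = L^{k+1} ≥ 2`, `a = ε∕M²`, `m = M`): `a² ≤ ε∕M³`; `τ = 5·(4(3M+2))·a ≤ 100ε∕M`, `τa ≤ 100ε∕M³`; `T_c = card n(a·(curl1C∕(1−θ_ℓε))·(M⁴∕M²)·E·(L∕L⁴)^{k+1} + 72a²)
≤ card n(2curl1C·E + 72)·ε∕M³`; `2a∕m = 2ε∕M³`; constant `C_F = C·Λ·(248 + 1200 + 2(card n(2curl1C·E + 72) + 1600) + 2) + 400`.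
WHAT ([folklore]; 0 def, 0 sorry).  **`exists_classFluxGradConst_generic`** (`2 ≤ L`): `∃ C ≥ 0` ∀ `N ≥ 1`, `0 < ε ≤ 1∕50`, `2·thetaLoc 4 L·ε ≤ 1`, the level family, `D`, `k`,
tangent-critical `U ∈ admissible (sfClass 4 L N ε) L (k+1) D`: `‖covGrad U (flux U) x j ⟨(μ,ν),h⟩‖ ≤ C·ε·(1 + (k+1))∕(L^{k+1})³` for all `x j` and `μ < ν`.
HONEST FRAMING (page 1): a repackaging of (c5) (elementary lattice analysis of OUR objects at a tangent-critical configuration + row NE7b's flat interior letter); tangent-criticality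
is a HYPOTHESIS on `U`; this is (10) TYPE WITH A LOGARITHM, not Bałaban's (10); nothing of Bałaban's asserted; NOT NE3∕NE7; row NE7b (`T4WeightBudget.RelWeightBound`) NOT
PRINTED ∕ NOT PROVED; spine count = dagwriter's call; finite T⁴ rung (B)+1 — NOT infinite volume, NOT mass gap, NOT BetaPertH, NOT Clay (continuum YM on T⁴ ⇐ BetaPertH ∧ nine spine
estimates).
-/

set_option autoImplicit false

open scoped BigOperators Matrix Matrix.Norms.L2Operator
open NormedSpace Finset

namespace Summit.QuantumFields.BalabanUV.T4Continuum.NE7ClassFluxGradBoundGeneric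

open Literature.MathematicalPhysics.QuantumFieldTheory.Balaban1983to89
open B7Prop1Explicit B7Prop2Explicit
open T4AveragingDeficitWall (IsUnitaryCfg IsSkewDir SmallField covGrad flux)
open T4AveragingDeficitWallBoundary (IsPeriodicCfg periodBox)
open AveragingDeficitPeriodicCounting (IsPeriodicDir)
open AveragingDeficitMultiLevelPrep (LevelSmall TangentIter)
open AveragingDeficitTwoLevelPrep (twoLevelSmall)
open BlockAverageVaryHolo (nbRad)
open MinimalActionLevels (perWin)
open MinimalActionSandwich (admissible)
open MinimalActionRate (sfClass)
open NE3HessForm (dAction)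
open NE3TangentCovariantTower (dirIter tangentIter_iff_dirIter_eq_zero)
open NE3QbarIterCovLiftPrep (cruxC)
open NE3RightInverseSolveLetters (thetaLoc cruxC_le_thetaLoc cruxC_nonneg)
open NE3HatInvCurlLetters (curl1C curl1C_nonneg)
open NE7ClassCurrentBoundGeneric (geom_identity)
open NE7FluxGradOfTanCritical (fluxGrad_le_of_tanCritical)

noncomputable section

variable {n : Type*} [Fintype n] [DecidableEq n]

set_option maxHeartbeats 800000 in
/-- **(10) TYPE UP TO A LOGARITHM FOR OUR TANGENT-CRITICAL CONFIGURATIONS OF THE CLASS, `d = 4`, ANY BLOCK SIZE `L ≥ 2`, ANY `U(n)`** (statement and arithmetic in the file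
header). [folklore] -/
theorem exists_classFluxGradConst_generic [Nonempty n] {L : ℕ} (hL : 2 ≤ L) :
    ∃ C : ℝ, 0 ≤ C ∧ ∀ (N : ℕ) [NeZero N] (ε : ℝ), 0 < ε → ε ≤ 1 / 50 → 2 * thetaLoc 4 L * ε ≤ 1 →
      (∀ k : ℕ, LevelSmall 4 L k (ε / ((L : ℝ) ^ (k + 1)) ^ 2)) →
      ∀ (D : Site 4 → Fin 4 → (Matrix n n ℂ)ˣ) (k : ℕ), ∀ U ∈ admissible (sfClass 4 L N ε) L (k + 1) D,
      (∀ φ : Site 4 → Fin 4 → Matrix n n ℂ, IsSkewDir φ → IsPeriodicDir φ ((N * L ^ (k + 1) : ℕ) : ℤ) → TangentIter L k U φ →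
        dAction U φ (perWin 4 (N * L ^ (k + 1))) = 0) →
      ∀ (x₀ : Site 4) (j μ ν : Fin 4) (h : μ < ν),
        ‖covGrad U (flux U) x₀ j ⟨(μ, ν), h⟩‖ ≤ C * ε * (1 + ((k + 1 : ℕ) : ℝ)) / ((L : ℝ) ^ (k + 1)) ^ 3 := by
  have hL1 : 1 ≤ L := Nat.le_trans (by norm_num) hL
  have hL0 : (0 : ℝ) < L := by exact_mod_cast hL1
  have hLr1 : (1 : ℝ) ≤ L := by exact_mod_cast hL1
  obtain ⟨C, hC, hletter⟩ := fluxGrad_le_of_tanCritical (d := 4) (n := n) (by norm_num)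
  -- the exponential constant of gen 91 at `d = 4`, block size `L`, and the block-size logarithm `Λ = 1 + log L`
  set E : ℝ := Real.exp (((L : ℝ) ^ 4 / L) * (((4 : ℕ) : ℝ) * (16 * (((4 : ℕ) : ℝ) + 1) * (((4 : ℕ) : ℝ) + 4) * (L : ℝ) ^ 2)
      * (1250 * ((nbRad 4 L : ℝ) + L) + 8 * (((4 : ℕ) : ℝ) * L) + 2 * L)) * (2 / twoLevelSmall 4 L)) with hE
  have hE0 : 0 ≤ E := (Real.exp_pos _).le
  set Λ : ℝ := 1 + Real.log (L : ℝ) with hΛ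
  have hΛ1 : 1 ≤ Λ := by rw [hΛ]; have := Real.log_nonneg hLr1; linarith
  have hΛ0 : 0 ≤ Λ := by linarith
  have hc0 := curl1C_nonneg 4 L
  -- the constant: `C·Λ·(248 + 1200 + 2(card n(2curl1C·E + 72) + 1600) + 2) + 400`
  refine ⟨C * Λ * (248 + 1200 + 2 * ((Fintype.card n : ℝ) * (2 * curl1C 4 L * E + 72) + 1600) + 2) + 400, by positivity, ?_⟩
  intro N _ ε hε hε' hθε hls D k U hU hcrit x₀ j μ ν hμν
  -- names and class data
  have hM0 : (0 : ℝ) < (L : ℝ) ^ (k + 1) := by positivity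
  have hM2 : (2 : ℝ) ≤ (L : ℝ) ^ (k + 1) := by
    have h1 : ((L : ℝ)) ^ 1 ≤ (L : ℝ) ^ (k + 1) := pow_le_pow_right₀ hLr1 (by omega)
    have h2 : (2 : ℝ) ≤ L := by exact_mod_cast hL
    rw [pow_one] at h1
    linarith
  set M : ℝ := (L : ℝ) ^ (k + 1) with hMdef
  have hM1 : 1 ≤ M := by linarith
  have hUu : IsUnitaryCfg U := hU.1.1
  have hUP : IsPeriodicCfg U ((N * L ^ (k + 1) : ℕ) : ℤ) := hU.1.2.1
  have hUx : SmallField U (ε / M ^ 2) := hU.1.2.2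
  have hx : 0 ≤ ε / M ^ 2 := by positivity
  have hs : LevelSmall 4 L k (ε / M ^ 2) := hls k
  have hMx : M ^ 2 * (ε / M ^ 2) = ε := by field_simp
  have hθl' : thetaLoc 4 L * ε < 1 := by linarith [mul_nonneg ((cruxC_nonneg 4 L).trans (cruxC_le_thetaLoc 4 L)) hε.le]
  have hθl : thetaLoc 4 L * (M ^ 2 * (ε / M ^ 2)) < 1 := by rw [hMx]; exact hθl'
  have hθ : cruxC 4 L * (M ^ 2 * (ε / M ^ 2)) < 1 := by
    rw [hMx]; exact lt_of_le_of_lt (mul_le_mul_of_nonneg_right (cruxC_le_thetaLoc 4 L) hε.le) hθl'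
  have hε1' : ε ≤ 1 := hε'.trans (by norm_num)
  have hε1 : M ^ 2 * (ε / M ^ 2) ≤ 1 := by rw [hMx]; exact hε1'
  have ha50 : ε / M ^ 2 ≤ 1 / 50 := by
    rw [div_le_iff₀ (by positivity)]
    nlinarith [one_le_pow₀ (M₀ := ℝ) (a := M) hM1 (n := 2), hε']
  have hcrit' : ∀ Y' : Site 4 → Fin 4 → Matrix n n ℂ, IsSkewDir Y' → IsPeriodicDir Y' ((N * L ^ (k + 1) : ℕ) : ℤ) →
      dirIter L (k + 1) U Y' = 0 → dAction U Y' (perWin 4 (N * L ^ (k + 1))) = 0 :=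
    fun Y' h1 h2 h3 => hcrit Y' h1 h2 ((tangentIter_iff_dirIter_eq_zero L k U Y').2 h3)
  -- the scale `m := L^{k+1}`
  have hmM : ((L ^ (k + 1) : ℕ) : ℝ) = M := by rw [hMdef]; push_cast; ring
  have hm1 : 1 ≤ L ^ (k + 1) := Nat.one_le_pow _ _ (by omega)
  -- THE LETTER at `a = x = ε/M²`, `m = M`
  have h := hletter hL k (N := N) hUu hUP hx hs hUx hθ hθl hε1 hx ha50 hUx hcrit' (L ^ (k + 1)) hm1 x₀ j μ ν hμν
  rw [hmM, ← hE, ← hMdef] at h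
  refine h.trans ?_
  -- the arithmetic
  set a : ℝ := ε / M ^ 2 with ha
  have ha0 : 0 ≤ a := hx
  -- `1 + log M ≤ Λ·(1 + (k+1))`
  set t : ℝ := 1 + ((k + 1 : ℕ) : ℝ) with ht
  have hk0' : (0 : ℝ) ≤ ((k + 1 : ℕ) : ℝ) := by positivity
  have ht1 : 1 ≤ t := by rw [ht]; linarith
  have hlog : 1 + Real.log M ≤ Λ * t := by
    rw [hMdef, Real.log_pow, hΛ, ht]
    have hlL : 0 ≤ Real.log (L : ℝ) := Real.log_nonneg hLr1
    push_cast
    nlinarith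
  have hlog0 : 0 ≤ 1 + Real.log M := by have := Real.log_nonneg hM1; linarith
  -- `a² ≤ ε/M³`, `τ ≤ 100 ε/M`, `τa ≤ 100 ε/M³`
  have hM3 : 0 < M ^ 3 := by positivity
  have haM : a = ε / M ^ 2 := rfl
  have ha2 : a ^ 2 ≤ ε / M ^ 3 := by
    rw [haM, div_pow, div_le_div_iff₀ (by positivity) hM3]
    have h1 : ε ^ 2 ≤ ε := by nlinarith
    have h2 : M ^ 3 ≤ (M ^ 2) ^ 2 := by nlinarith [pow_le_pow_right₀ hM1 (show 3 ≤ 4 by norm_num)]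
    calc ε ^ 2 * M ^ 3 ≤ ε * M ^ 3 := by nlinarith [hM3, h1]
      _ ≤ ε * (M ^ 2) ^ 2 := by nlinarith [hε.le]
  set τ : ℝ := ((((4 + 1) * (4 * (3 * L ^ (k + 1) + 2)) : ℕ) : ℝ) * a) with hτ
  have hτle : τ ≤ 100 * ε / M := by
    rw [hτ, haM]
    have e1 : ((((4 + 1) * (4 * (3 * L ^ (k + 1) + 2)) : ℕ)) : ℝ) = 20 * (3 * M + 2) := by rw [hMdef]; push_cast; ring
    rw [e1, show 20 * (3 * M + 2) * (ε / M ^ 2) = (20 * (3 * M + 2) * ε) / M ^ 2 by ring, div_le_div_iff₀ (by positivity) hM0]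
    have : 3 * M + 2 ≤ 5 * M := by linarith
    have hεM : 0 ≤ ε * M := by positivity
    calc 20 * (3 * M + 2) * ε * M = 20 * (3 * M + 2) * (ε * M) := by ring
      _ ≤ 20 * (5 * M) * (ε * M) := by nlinarith
      _ = 100 * ε * M ^ 2 := by ring
  have hτ0 : 0 ≤ τ := by rw [hτ]; positivity
  have hτa : τ * a ≤ 100 * (ε / M ^ 3) := by
    have h1 : τ * a ≤ (100 * ε / M) * (ε / M ^ 2) := by rw [← haM]; exact mul_le_mul_of_nonneg_right hτle ha0
    have e : (100 * ε / M) * (ε / M ^ 2) = 100 * (ε * (ε / M ^ 3)) := by field_simp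
    rw [e] at h1
    have h2 : ε * (ε / M ^ 3) ≤ 1 * (ε / M ^ 3) := mul_le_mul_of_nonneg_right hε1' (by positivity)
    linarith
  -- the tension constant: main term `≤ 2 curl1C E ε/M³`, `a²`-term
  have hgeom : M ^ 4 / M ^ 2 * (((L : ℝ)) / (L : ℝ) ^ 4) ^ (k + 1) = 1 / M := by rw [hMdef]; exact geom_identity hL1 k
  have hθε' : 1 - thetaLoc 4 L * ε ≥ 1 / 2 := by linarith
  have hmain : (a * ((curl1C 4 L / (1 - thetaLoc 4 L * (M ^ 2 * a))) * (M ^ 4 / M ^ 2))) * (E * (((L : ℝ)) / (L : ℝ) ^ 4) ^ (k + 1))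
      ≤ 2 * curl1C 4 L * E * (ε / M ^ 3) := by
    rw [hMx, haM]
    have e1 : (ε / M ^ 2 * ((curl1C 4 L / (1 - thetaLoc 4 L * ε)) * (M ^ 4 / M ^ 2))) * (E * (((L : ℝ)) / (L : ℝ) ^ 4) ^ (k + 1))
        = (curl1C 4 L / (1 - thetaLoc 4 L * ε)) * E * (ε / M ^ 2 * (M ^ 4 / M ^ 2 * (((L : ℝ)) / (L : ℝ) ^ 4) ^ (k + 1))) := by ring
    rw [e1, hgeom, show ε / M ^ 2 * (1 / M) = ε / M ^ 3 by rw [div_mul_div_comm, mul_one, ← pow_succ]]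
    have h2 : curl1C 4 L / (1 - thetaLoc 4 L * ε) ≤ 2 * curl1C 4 L := by
      rw [div_le_iff₀ (by linarith)]; nlinarith
    have h3 : 0 ≤ ε / M ^ 3 := by positivity
    have := mul_le_mul_of_nonneg_right (mul_le_mul_of_nonneg_right h2 hE0) h3
    linarith
  have hcard : (0 : ℝ) ≤ (Fintype.card n : ℝ) := Nat.cast_nonneg _
  have hP6 : (Fintype.card (T4AveragingDeficitWall.Plane 4) : ℝ) = 6 := by
    rw [show Fintype.card (T4AveragingDeficitWall.Plane 4) = 6 from by rfl]; norm_num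
  have hTc : (Fintype.card n : ℝ) * ((a * ((curl1C 4 L / (1 - thetaLoc 4 L * (M ^ 2 * a))) * (M ^ 4 / M ^ 2)))
        * (E * (((L : ℝ)) / (L : ℝ) ^ 4) ^ (k + 1)) + 12 * (Fintype.card (T4AveragingDeficitWall.Plane 4) : ℝ) * a ^ 2)
      ≤ (Fintype.card n : ℝ) * (2 * curl1C 4 L * E + 72) * (ε / M ^ 3) := by
    rw [hP6]
    have t := add_le_add hmain (mul_le_mul_of_nonneg_left ha2 (by norm_num : (0 : ℝ) ≤ 12 * 6))
    have := mul_le_mul_of_nonneg_left t hcard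
    have e : (Fintype.card n : ℝ) * (2 * curl1C 4 L * E + 72) * (ε / M ^ 3) = (Fintype.card n : ℝ) * (2 * curl1C 4 L * E * (ε / M ^ 3) + 12 * 6 * (ε / M ^ 3)) := by ring
    rw [e]; exact this
  -- assemble: every bracket term `≤ (const)·ε/M³`
  set K₀ : ℝ := 248 + 1200 + 2 * ((Fintype.card n : ℝ) * (2 * curl1C 4 L * E + 72) + 1600) with hK₀
  have hQ : 248 * a ^ 2 + 12 * τ * a
        + 2 * ((Fintype.card n : ℝ) * ((a * ((curl1C 4 L / (1 - thetaLoc 4 L * (M ^ 2 * a))) * (M ^ 4 / M ^ 2)))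
            * (E * (((L : ℝ)) / (L : ℝ) ^ 4) ^ (k + 1)) + 12 * (Fintype.card (T4AveragingDeficitWall.Plane 4) : ℝ) * a ^ 2)
          + 4 * ((4 : ℕ) : ℝ) * τ * a)
      ≤ K₀ * (ε / M ^ 3) := by
    have t1 : 248 * a ^ 2 ≤ 248 * (ε / M ^ 3) := by linarith
    have t2 : 12 * τ * a ≤ 1200 * (ε / M ^ 3) := by linarith [hτa]
    have t3 : 4 * ((4 : ℕ) : ℝ) * τ * a ≤ 1600 * (ε / M ^ 3) := by push_cast; linarith [hτa]
    rw [hK₀]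
    linarith [hTc, t1, t2, t3]
  have hQ0 : 0 ≤ 248 * a ^ 2 + 12 * τ * a
        + 2 * ((Fintype.card n : ℝ) * ((a * ((curl1C 4 L / (1 - thetaLoc 4 L * (M ^ 2 * a))) * (M ^ 4 / M ^ 2)))
            * (E * (((L : ℝ)) / (L : ℝ) ^ 4) ^ (k + 1)) + 12 * (Fintype.card (T4AveragingDeficitWall.Plane 4) : ℝ) * a ^ 2)
          + 4 * ((4 : ℕ) : ℝ) * τ * a) := by
    have hpos : 0 < 1 - thetaLoc 4 L * (M ^ 2 * a) := by rw [hMx]; linarith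
    positivity
  have hεM3 : 0 ≤ ε / M ^ 3 := by positivity
  have hK₀0 : 0 ≤ K₀ := by rw [hK₀]; positivity
  -- the final inequality, with `r := ε/M³`: `C((1+log M)Q + 2a/M) + 4τa ≤ CΛt(K₀+2)r + 400 t r`
  have h2a : 2 * a / M = 2 * (ε / M ^ 3) := by rw [haM]; field_simp
  have u1 : (1 + Real.log M) * (248 * a ^ 2 + 12 * τ * a
        + 2 * ((Fintype.card n : ℝ) * ((a * ((curl1C 4 L / (1 - thetaLoc 4 L * (M ^ 2 * a))) * (M ^ 4 / M ^ 2)))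
            * (E * (((L : ℝ)) / (L : ℝ) ^ 4) ^ (k + 1)) + 12 * (Fintype.card (T4AveragingDeficitWall.Plane 4) : ℝ) * a ^ 2)
          + 4 * ((4 : ℕ) : ℝ) * τ * a))
      ≤ (Λ * t) * (K₀ * (ε / M ^ 3)) := mul_le_mul hlog hQ hQ0 (by positivity)
  have u2 : 2 * (ε / M ^ 3) ≤ (Λ * t) * (2 * (ε / M ^ 3)) := le_mul_of_one_le_left (by positivity) (one_le_mul_of_one_le_of_one_le hΛ1 ht1)
  have u3 : 4 * τ * a ≤ t * (400 * (ε / M ^ 3)) := by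
    have : 4 * τ * a ≤ 400 * (ε / M ^ 3) := by linarith [hτa]
    exact this.trans (le_mul_of_one_le_left (by positivity) ht1)
  have u4 : C * ((1 + Real.log M) * (248 * a ^ 2 + 12 * τ * a
        + 2 * ((Fintype.card n : ℝ) * ((a * ((curl1C 4 L / (1 - thetaLoc 4 L * (M ^ 2 * a))) * (M ^ 4 / M ^ 2)))
            * (E * (((L : ℝ)) / (L : ℝ) ^ 4) ^ (k + 1)) + 12 * (Fintype.card (T4AveragingDeficitWall.Plane 4) : ℝ) * a ^ 2)
          + 4 * ((4 : ℕ) : ℝ) * τ * a)) + 2 * a / M)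
      ≤ C * ((Λ * t) * (K₀ * (ε / M ^ 3)) + (Λ * t) * (2 * (ε / M ^ 3))) := by
    rw [h2a]
    exact mul_le_mul_of_nonneg_left (add_le_add u1 u2) hC
  have e3 : (C * Λ * (K₀ + 2) + 400) * ε * t / M ^ 3
      = C * ((Λ * t) * (K₀ * (ε / M ^ 3)) + (Λ * t) * (2 * (ε / M ^ 3))) + t * (400 * (ε / M ^ 3)) := by
    ring
  rw [e3]
  linarith [u3, u4]

end

end Summit.QuantumFields.BalabanUV.T4Continuum.NE7ClassFluxGradBoundGeneric
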